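import Mathlib

/-!
# BridgeProjector — eigenprojectors are polynomials in one correspondence (Tier 4, T4-A)

Seat p4 of the blind cell pub-hodge-repro2 (README §6, T4-A). The prose bridge argument (route/TIER4.md
T4-A; route/TIER3.md §6 item 16) projects the Gysin class `f_*[S]` to the (1,1,1,1)-Künneth piece and
then to the split Weil line and asserts that these projectors are "algebraic correspondences on `B`"
— polynomials in the pull-backs along endomorphisms of the abelian variety `B`. This file proves the
linear algebra behind that sentence, with no geometry:

Let `T` be an endomorphism of a vector space `V` over a field `F` (the role of `([n₁] × ⋯ × [n₄])^*`
on `H⁴(B, ℚ)`, or of an element of `𝐅 ⊗ 𝐅 ⊗ 𝐅 ⊗ 𝐅` acting on the Künneth piece), and let `V` be spanned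
by finitely many subspaces `V i` on which `T` acts by pairwise distinct scalars `μ i` (the Künneth
pieces, on which `([n₁] × ⋯ × [n₄])^*` acts by `∏ nᵢ^{aᵢ}`). Then the Lagrange polynomial `Lᵢ` with
`Lᵢ(μ j) = δᵢⱼ` evaluated at `T` is

* the identity on `V i` (`proj_apply_of_mem_self`),
* zero on `V j` for `j ≠ i` (`proj_apply_of_mem_ne`),
* a map of `V` into `V i` (`proj_apply_mem`), idempotent (`proj_proj`), and the `proj i` sum to the
  identity (`sum_proj`);
* and — the point — it maps every `T`-stable subspace `A` into `A ⊓ V i` (`proj_apply_mem_inf`): if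
  `T` preserves algebraic classes, so does the projector onto each `V i`, and the `V i`-component of an
  algebraic class is algebraic.

Applied to the bridge: with `T = ([2] × [3] × [5] × [7])^*` on `H⁴(B, ℚ) = ⨁ ⊗ᵢ H^{aᵢ}(A_{Tᵢ}, ℚ)`
(eigenvalue `2^{a₁} 3^{a₂} 5^{a₃} 7^{a₄}`, injective in `(a₁, …, a₄)` by unique factorisation), the
(1,1,1,1)-Künneth projector is `proj (1,1,1,1)`, a ℚ-polynomial in one algebraic correspondence.
-/

namespace Summit.Ventures.HodgeRepro2.BridgeProjector

open Polynomial

section Eigen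

variable {F : Type*} [Field F] {V : Type*} [AddCommGroup V] [Module F V]
  {ι : Type*} [Fintype ι] [DecidableEq ι]

/-- **Eigen-decomposition data for one operator.** `T` is an endomorphism of `V`, the subspaces `V i`
span `V`, `T` acts on `V i` as the scalar `μ i`, and the scalars are pairwise distinct. -/
structure EigenData (T : Module.End F V) (V_ : ι → Submodule F V) (μ : ι → F) where
  /-- the `V i` span `V` -/
  iSup_eq_top : ⨆ i, V_ i = ⊤
  /-- `T` is the scalar `μ i` on `V i` -/
  apply_eq_smul : ∀ i, ∀ v ∈ V_ i, T v = μ i • v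
  /-- the scalars are pairwise distinct -/
  injective : Function.Injective μ

variable {T : Module.End F V} {V_ : ι → Submodule F V} {μ : ι → F}

omit [Fintype ι] [DecidableEq ι] in
/-- `T ^ n` is the scalar `μ i ^ n` on `V i`. -/
theorem EigenData.pow_apply_eq_smul (h : EigenData T V_ μ) (i : ι) {v : V} (hv : v ∈ V_ i) (n : ℕ) :
    (T ^ n) v = μ i ^ n • v := by
  induction n with
  | zero => simp
  | succ n ih =>
    rw [pow_succ, Module.End.mul_apply, h.apply_eq_smul i v hv, map_smul, ih, smul_smul, pow_succ,
      mul_comm]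

omit [Fintype ι] [DecidableEq ι] in
/-- Every polynomial in `T` acts on `V i` as the scalar `p(μ i)`. -/
theorem EigenData.aeval_apply_eq_smul (h : EigenData T V_ μ) (i : ι) {v : V} (hv : v ∈ V_ i)
    (p : F[X]) : (aeval T p) v = p.eval (μ i) • v := by
  induction p using Polynomial.induction_on' with
  | add p q hp hq => rw [map_add, LinearMap.add_apply, hp, hq, eval_add, add_smul]
  | monomial n a =>
    rw [aeval_monomial, eval_monomial, Module.End.mul_apply, h.pow_apply_eq_smul i hv n, map_smul,
      Module.algebraMap_end_apply, smul_smul, mul_comm]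

/-- A `T`-stable subspace is stable under every polynomial in `T`. -/
theorem aeval_apply_mem_of_stable (A : Submodule F V) (hA : ∀ v ∈ A, T v ∈ A) (p : F[X]) {v : V}
    (hv : v ∈ A) : (aeval T p) v ∈ A := by
  induction p using Polynomial.induction_on' with
  | add p q hp hq => rw [map_add, LinearMap.add_apply]; exact A.add_mem hp hq
  | monomial n a =>
    rw [aeval_monomial, Module.End.mul_apply, Module.algebraMap_end_apply]
    refine A.smul_mem a ?_
    induction n with
    | zero => simpa using hv
    | succ n ih => rw [pow_succ', Module.End.mul_apply]; exact hA _ ih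

/-- **The eigenprojector as a polynomial in `T`**: the Lagrange basis polynomial `Lᵢ` (with
`Lᵢ(μ j) = δᵢⱼ`) evaluated at `T`. -/
noncomputable def proj (T : Module.End F V) (μ : ι → F) (i : ι) : Module.End F V :=
  aeval T (Lagrange.basis Finset.univ μ i)

/-- `proj i` is the identity on `V i`. -/
theorem EigenData.proj_apply_of_mem_self (h : EigenData T V_ μ) (i : ι) {v : V} (hv : v ∈ V_ i) :
    proj T μ i v = v := by
  rw [proj, h.aeval_apply_eq_smul i hv,
    Lagrange.eval_basis_self (Set.injOn_of_injective h.injective) (Finset.mem_univ i), one_smul]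

/-- `proj i` vanishes on `V j` for `j ≠ i`. -/
theorem EigenData.proj_apply_of_mem_ne (h : EigenData T V_ μ) {i j : ι} (hij : i ≠ j) {v : V}
    (hv : v ∈ V_ j) : proj T μ i v = 0 := by
  rw [proj, h.aeval_apply_eq_smul j hv, Lagrange.eval_basis_of_ne hij (Finset.mem_univ j), zero_smul]

/-- `proj i` maps all of `V` into `V i`. -/
theorem EigenData.proj_apply_mem (h : EigenData T V_ μ) (i : ι) (v : V) : proj T μ i v ∈ V_ i := by
  have hv : v ∈ ⨆ j, V_ j := by rw [h.iSup_eq_top]; exact Submodule.mem_top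
  refine Submodule.iSup_induction V_ (motive := fun x => proj T μ i x ∈ V_ i) hv ?_ ?_ ?_
  · intro j x hx
    by_cases hij : i = j
    · subst hij
      rw [h.proj_apply_of_mem_self i hx]
      exact hx
    · rw [h.proj_apply_of_mem_ne hij hx]
      exact (V_ i).zero_mem
  · rw [map_zero]
    exact (V_ i).zero_mem
  · intro x y hx hy
    rw [map_add]
    exact (V_ i).add_mem hx hy

/-- `proj i` is idempotent. -/
theorem EigenData.proj_proj (h : EigenData T V_ μ) (i : ι) (v : V) :
    proj T μ i (proj T μ i v) = proj T μ i v :=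
  h.proj_apply_of_mem_self i (h.proj_apply_mem i v)

/-- The eigenprojectors sum to the identity. -/
theorem EigenData.sum_proj [Nonempty ι] (h : EigenData T V_ μ) :
    ∑ i, proj T μ i = (1 : Module.End F V) := by
  simp only [proj]
  rw [← map_sum, Lagrange.sum_basis (Set.injOn_of_injective h.injective) Finset.univ_nonempty,
    map_one]

/-- **The point of the file.** If `A` is `T`-stable (algebraic classes are stable under the
correspondence `T`), then `proj i` maps `A` into `A ⊓ V i`: the `V i`-component of an algebraic class
is again algebraic. -/
theorem EigenData.proj_apply_mem_inf (h : EigenData T V_ μ) (A : Submodule F V)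
    (hA : ∀ v ∈ A, T v ∈ A) (i : ι) {v : V} (hv : v ∈ A) : proj T μ i v ∈ A ⊓ V_ i :=
  ⟨aeval_apply_mem_of_stable A hA _ hv, h.proj_apply_mem i v⟩

/-- Consequently `A` is the (internal) sum of its pieces `A ⊓ V i`: every `v ∈ A` is the sum of its
projections, each of which lies in `A ⊓ V i`. -/
theorem EigenData.eq_sum_proj [Nonempty ι] (h : EigenData T V_ μ) (v : V) :
    v = ∑ i, proj T μ i v := by
  have := congrArg (fun f : Module.End F V => f v) h.sum_proj
  simpa [LinearMap.sum_apply] using this.symm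

end Eigen

end Summit.Ventures.HodgeRepro2.BridgeProjector
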